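import Mathlib.Analysis.MellinTransform
import Mathlib.NumberTheory.LSeries.SumCoeff
import HarnessLib

/-!
# Continuation of a Dirichlet series from an asymptotic formula for its partial sums (Landau)

Topic `Literature/NumberTheory/LFunctions`, abstracting `DedekindZetaHalfPlaneProofs.lean` (where the
sequence is the ideal count of a number field). Everything in this file is PROVED.

**Landau's partial-summation continuation** (E. Landau, Math. Ann. 56 (1903), §9 p. 666, property 1),
for `ζ_K`; Montgomery–Vaughan, *Multiplicative Number Theory I*, Theorem 1.3 and p. 267): if the
partial sums of `a : ℕ → ℂ` satisfy

  `‖∑_{k ≤ N} a(k) − ρ N‖ ≤ C₀ N^θ`  for all `N ≥ 1`   (`0 ≤ θ < 1`, `ρ ∈ ℂ`),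

and `∑ a(n) n^{-s}` converges absolutely for `σ > 1`, then
`L(a, s) = s ∫₁^∞ A(t) t^{-s-1} dt = ρ s/(s − 1) + s ∫₁^∞ E(t) t^{-s-1} dt` (`E(t) = A(t) − ρt`), the
last integral being holomorphic for `σ > θ` and bounded by `(C₀ + ‖ρ‖)/(σ − θ)`. Hence:

* `contG a ρ s = ρ s + s(s − 1)·𝓜(E)(−s)` is holomorphic on `σ > θ`, equals `(s − 1) L(a, s)` for
  `σ > 1`, takes the value `ρ` at `s = 1`, and
  `‖contG a ρ s‖ ≤ ‖ρ‖‖s‖ + ‖s‖‖s − 1‖(C₀ + ‖ρ‖)/(σ − θ)` (`differentiableOn_contG`, `contG_eq_mul`,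
  `contG_one`, `norm_contG_le`);
* in the pole-free case `ρ = 0`: `contF a s = s·𝓜(E)(−s)` is holomorphic on `σ > θ`, equals `L(a, s)`
  for `σ > 1`, and `‖contF a s‖ ≤ ‖s‖ C₀/(σ − θ)` (`differentiableOn_contF`, `contF_eq_LSeries`,
  `norm_contF_le`) — exactly the fields `differentiableOn`, `growth` of `TwistedZFRData`
  (`TwistedZeroFreeRegion.lean`) for `F = L(s, ν)` once the twisted ideal count
  `∑_{N𝔞 ≤ x} ν(𝔞) = O(Q^B x^θ)` is known (the conductor `Q` enters only through `C₀ = C Q^B`).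

**Purpose.** The continuation of the Hecke `L`-functions `L(s, ν)` of `K = ℚ(∛2)` to a half-plane
`σ > θ` with polynomial growth in the conductor, towards Mitsui's prime number theorem with
Grössencharaktere (T. Mitsui, Jap. J. Math. 26 (1956), Lemma 5) = Lemma 9.4 of D. R. Heath-Brown,
*Primes represented by `x³ + 2y³`*, Acta Math. 186 (2001).

## References

* E. Landau, *Neuer Beweis des Primzahlsatzes und Beweis des Primidealsatzes*, Math. Ann. 56
  (1903), 645–670, Part II §9, p. 666. [cite: LandauMathAnn1903, §9 p. 666]
* H. L. Montgomery, R. C. Vaughan, *Multiplicative Number Theory I. Classical Theory*, CUP 2007,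
  Theorem 1.3 and p. 267. [cite: MontgomeryVaughan2007, Theorem 1.3 and p. 267]

## Mathlib / tree search

Mathlib: `LSeries_eq_mul_integral` (MV Thm 1.3), `mellin`, `mellin_differentiableAt_of_isBigO_rpow`,
`integral_Ioi_rpow_of_lt`, `integral_Ioi_cpow_of_lt`, `Nat.measurable_floor`, `measurable_from_nat`.
Tree: `DedekindZetaHalfPlaneProofs` (`landauG`, the special case `a = ` ideal count, `θ = 1 − 1/d`);
this file is its abstraction (`lean search 'contG|PartialSumContinuation|mellin.*errorTerm'`: nothing).
-/

noncomputable section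

open Complex Filter Set Topology Finset MeasureTheory Asymptotics

namespace Literature.NumberTheory.LFunctions

namespace PartialSumContinuation

variable (a : ℕ → ℂ) (ρ : ℂ)

/-! ### The partial sums, the error term and its basic properties -/

/-- The partial sum `A(t) = ∑_{1 ≤ k ≤ t} a(k)`. [folklore] -/
def partialSum (t : ℝ) : ℂ := ∑ k ∈ Icc 1 ⌊t⌋₊, a k

/-- The error term `E(t) = A(t) − ρt`. [cite: MontgomeryVaughan2007, p. 267] -/
def errorTerm (t : ℝ) : ℂ := partialSum a t - ρ * t

/-- `E` extended by `0` on `t ≤ 1` (the function whose Mellin transform at `−s` is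
`∫₁^∞ E(t) t^{−s−1} dt`). [folklore] -/
def errorTermC : ℝ → ℂ := (Set.Ioi (1 : ℝ)).indicator (errorTerm a ρ)

/-- Landau's `G(s) = ρ s + s(s − 1) ∫₁^∞ E(t) t^{−s−1} dt`, the candidate for `(s − 1)L(a, s)` on
`σ > θ`. [cite: MontgomeryVaughan2007, p. 267] -/
def contG (s : ℂ) : ℂ := ρ * s + s * (s - 1) * mellin (errorTermC a ρ) (-s)

/-- The pole-free candidate `F(s) = s ∫₁^∞ A(t) t^{−s−1} dt` for `L(a, s)` itself (`ρ = 0`).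
[cite: MontgomeryVaughan2007, Theorem 1.3] -/
def contF (s : ℂ) : ℂ := s * mellin (errorTermC a 0) (-s)

/-- `t ↦ A(t)` is measurable (it factors through `⌊t⌋`). [folklore] -/
theorem measurable_partialSum : Measurable (partialSum a) :=
  (measurable_from_nat (f := fun N : ℕ ↦ ∑ k ∈ Icc 1 N, a k)).comp Nat.measurable_floor

/-- `E` is measurable. [folklore] -/
theorem measurable_errorTerm : Measurable (errorTerm a ρ) :=
  (measurable_partialSum a).sub (measurable_const.mul (Complex.measurable_ofReal.comp measurable_id))

/-- `errorTermC` is measurable. [folklore] -/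
theorem measurable_errorTermC : Measurable (errorTermC a ρ) :=
  (measurable_errorTerm a ρ).indicator measurableSet_Ioi

/-- A crude local bound: for `t ∈ [A, B]`, `‖E(t)‖ ≤ ∑_{k ≤ B} ‖a(k)‖ + ‖ρ‖(|A| + |B|)`. [folklore] -/
theorem norm_errorTerm_le_of_mem_Icc {A B t : ℝ} (ht : t ∈ Set.Icc A B) :
    ‖errorTerm a ρ t‖ ≤ (∑ k ∈ Icc 1 ⌊B⌋₊, ‖a k‖) + ‖ρ‖ * (|A| + |B|) := by
  have h1 : ‖partialSum a t‖ ≤ ∑ k ∈ Icc 1 ⌊B⌋₊, ‖a k‖ := by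
    unfold partialSum
    refine (norm_sum_le _ _).trans ?_
    refine Finset.sum_le_sum_of_subset_of_nonneg ?_ (fun _ _ _ ↦ norm_nonneg _)
    exact Finset.Icc_subset_Icc_right (Nat.floor_le_floor ht.2)
  have h2 : |t| ≤ |A| + |B| := by
    rcases le_total 0 t with h | h
    · rw [abs_of_nonneg h]; linarith [le_abs_self B, ht.2, abs_nonneg A]
    · rw [abs_of_nonpos h]; linarith [neg_abs_le A, ht.1, abs_nonneg B]
  unfold errorTerm
  calc ‖partialSum a t - ρ * t‖ ≤ ‖partialSum a t‖ + ‖ρ * (t : ℂ)‖ := norm_sub_le _ _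
    _ ≤ (∑ k ∈ Icc 1 ⌊B⌋₊, ‖a k‖) + ‖ρ‖ * (|A| + |B|) := by
        rw [norm_mul, Complex.norm_real, Real.norm_eq_abs]
        exact add_le_add h1 (mul_le_mul_of_nonneg_left h2 (norm_nonneg _))

/-- `errorTermC` is locally integrable (bounded on bounded sets and measurable). [folklore] -/
theorem locallyIntegrable_errorTermC : LocallyIntegrable (errorTermC a ρ) := by
  rw [MeasureTheory.locallyIntegrable_iff]
  intro k hk
  rcases k.eq_empty_or_nonempty with rfl | hne
  · exact integrableOn_empty
  obtain ⟨A, hA⟩ := hk.bddBelow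
  obtain ⟨B, hB⟩ := hk.bddAbove
  have hsub : k ⊆ Set.Icc A B := fun x hx ↦ ⟨hA hx, hB hx⟩
  refine IntegrableOn.mono_set ?_ hsub
  refine Measure.integrableOn_of_bounded (M := (∑ k ∈ Icc 1 ⌊B⌋₊, ‖a k‖) + ‖ρ‖ * (|A| + |B|))
    (by simp) (measurable_errorTermC a ρ).aestronglyMeasurable ?_
  refine ae_restrict_of_forall_mem measurableSet_Icc fun t ht ↦ ?_
  unfold errorTermC
  rcases em (t ∈ Set.Ioi (1 : ℝ)) with h | h
  · rw [Set.indicator_of_mem h]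
    exact norm_errorTerm_le_of_mem_Icc a ρ ht
  · rw [Set.indicator_of_notMem h, norm_zero]
    positivity

/-- Near `0⁺` the function `errorTermC` vanishes, so it is `O(t^{−b})` for every `b`. [folklore] -/
theorem isBigO_errorTermC_nhdsGT_zero (b : ℝ) :
    errorTermC a ρ =O[𝓝[>] 0] fun t : ℝ ↦ t ^ (-b) := by
  refine IsBigO.of_bound 0 ?_
  filter_upwards [Ioo_mem_nhdsGT (zero_lt_one' ℝ)] with t ht
  have : t ∉ Set.Ioi (1 : ℝ) := fun h ↦ (lt_irrefl _ (ht.2.trans h))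
  simp [errorTermC, Set.indicator_of_notMem this]

/-- The Mellin transform of `errorTermC` is `∫₁^∞ t^{z−1} E(t) dt`. [folklore] -/
theorem mellin_errorTermC (z : ℂ) :
    mellin (errorTermC a ρ) z = ∫ t in Set.Ioi (1 : ℝ), (t : ℂ) ^ (z - 1) * errorTerm a ρ t := by
  simp only [mellin, smul_eq_mul, errorTermC]
  have : (fun t : ℝ ↦ (t : ℂ) ^ (z - 1) * (Set.Ioi (1 : ℝ)).indicator (errorTerm a ρ) t) =
      (Set.Ioi (1 : ℝ)).indicator fun t ↦ (t : ℂ) ^ (z - 1) * errorTerm a ρ t :=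
    funext fun t ↦ (Set.indicator_mul_right (Set.Ioi (1 : ℝ)) (fun u : ℝ ↦ (u : ℂ) ^ (z - 1))
      (errorTerm a ρ)).symm
  rw [this, setIntegral_indicator measurableSet_Ioi,
    Set.inter_eq_right.mpr (Set.Ioi_subset_Ioi zero_le_one)]

/-- `G(1) = ρ`. [folklore] -/
theorem contG_one : contG a ρ 1 = ρ := by simp [contG]

/-! ### Under the hypothesis `‖A(N) − ρN‖ ≤ C₀ N^θ` -/

section Hyp

variable {a ρ} {C₀ θ : ℝ} (hθ0 : 0 ≤ θ)
  (hA : ∀ N : ℕ, 1 ≤ N → ‖∑ k ∈ Icc 1 N, a k - ρ * N‖ ≤ C₀ * (N : ℝ) ^ θ)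
include hθ0 hA

omit hθ0 in
/-- `0 ≤ C₀`. [folklore] -/
theorem C₀_nonneg : 0 ≤ C₀ := by
  have := (norm_nonneg _).trans (hA 1 le_rfl)
  simpa using this

/-- **The error term for real `t ≥ 1`**: `‖E(t)‖ ≤ (C₀ + ‖ρ‖) t^θ`
(`E(t) = (A(⌊t⌋) − ρ⌊t⌋) − ρ(t − ⌊t⌋)`). [folklore] -/
theorem norm_errorTerm_le {t : ℝ} (ht : 1 ≤ t) : ‖errorTerm a ρ t‖ ≤ (C₀ + ‖ρ‖) * t ^ θ := by
  have ht0 : 0 ≤ t := by linarith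
  set N : ℕ := ⌊t⌋₊ with hN
  have hN1 : 1 ≤ N := by rw [hN]; exact Nat.le_floor (by exact_mod_cast ht)
  have hNt : (N : ℝ) ≤ t := Nat.floor_le ht0
  have htN : t - N ≤ 1 := by have := Nat.lt_floor_add_one t; rw [← hN] at this; linarith
  have htN0 : 0 ≤ t - N := by linarith
  have hC₀ := C₀_nonneg hA
  have h1 := hA N hN1
  have hsplit : errorTerm a ρ t = (∑ k ∈ Icc 1 N, a k - ρ * N) - ρ * ((t - N : ℝ) : ℂ) := by
    unfold errorTerm partialSum; push_cast; ring
  have htθ : 1 ≤ t ^ θ := Real.one_le_rpow ht hθ0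
  have hNθ : (N : ℝ) ^ θ ≤ t ^ θ := Real.rpow_le_rpow (Nat.cast_nonneg _) hNt hθ0
  rw [hsplit]
  calc ‖(∑ k ∈ Icc 1 N, a k - ρ * N) - ρ * ((t - N : ℝ) : ℂ)‖
      ≤ ‖∑ k ∈ Icc 1 N, a k - ρ * N‖ + ‖ρ * ((t - N : ℝ) : ℂ)‖ := norm_sub_le _ _
    _ ≤ C₀ * (N : ℝ) ^ θ + ‖ρ‖ * 1 := by
        refine add_le_add h1 ?_
        rw [norm_mul, Complex.norm_real, Real.norm_of_nonneg htN0]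
        exact mul_le_mul_of_nonneg_left htN (norm_nonneg _)
    _ ≤ C₀ * t ^ θ + ‖ρ‖ * t ^ θ := by gcongr
    _ = (C₀ + ‖ρ‖) * t ^ θ := by ring

/-- `E(t) = O(t^θ)` at `+∞`, in the form needed by the Mellin machinery. [folklore] -/
theorem isBigO_errorTermC_atTop : errorTermC a ρ =O[atTop] fun t : ℝ ↦ t ^ (-(-θ)) := by
  refine IsBigO.of_bound (C₀ + ‖ρ‖) ?_
  filter_upwards [eventually_ge_atTop (1 : ℝ)] with t ht
  have ht0 : 0 < t := by linarith
  rw [Real.norm_of_nonneg (Real.rpow_nonneg ht0.le _), neg_neg]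
  unfold errorTermC
  rcases em (t ∈ Set.Ioi (1 : ℝ)) with h1 | h1
  · rw [Set.indicator_of_mem h1]
    exact norm_errorTerm_le hθ0 hA ht
  · rw [Set.indicator_of_notMem h1, norm_zero]
    have := C₀_nonneg hA
    positivity

/-- The Mellin transform `s ↦ ∫₁^∞ E(t) t^{−s−1} dt` is holomorphic on `σ > θ`. [folklore] -/
theorem differentiableAt_mellin_errorTermC {s : ℂ} (hs : θ < s.re) :
    DifferentiableAt ℂ (fun z ↦ mellin (errorTermC a ρ) (-z)) s := by
  have hd : DifferentiableAt ℂ (mellin (errorTermC a ρ)) (-s) := by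
    refine mellin_differentiableAt_of_isBigO_rpow (a := -θ)
      (b := -s.re - 1) ((locallyIntegrable_errorTermC a ρ).locallyIntegrableOn _)
      (isBigO_errorTermC_atTop hθ0 hA) ?_ (isBigO_errorTermC_nhdsGT_zero a ρ _) ?_
    · simp only [neg_re]; linarith
    · simp only [neg_re]; linarith
  exact hd.comp s (differentiable_neg s)

/-- **`G` is holomorphic on `σ > θ`.** [cite: LandauMathAnn1903, §9 p. 666] -/
theorem differentiableOn_contG : DifferentiableOn ℂ (contG a ρ) {s : ℂ | θ < s.re} := by
  intro s hs
  have hm := differentiableAt_mellin_errorTermC hθ0 hA (s := s) hs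
  have : contG a ρ = fun z ↦ ρ * z + z * (z - 1) * mellin (errorTermC a ρ) (-z) := rfl
  rw [this]
  exact (((differentiableAt_const _).mul differentiableAt_id).add
    ((differentiableAt_id.mul (differentiableAt_id.sub (differentiableAt_const _))).mul
      hm)).differentiableWithinAt

/-- Pointwise bound `‖t^{−s−1} E(t)‖ ≤ (C₀ + ‖ρ‖) t^{−(σ + 1 − θ)}` for `t > 1`. [folklore] -/
theorem norm_cpow_mul_errorTerm_le (s : ℂ) {t : ℝ} (ht : 1 < t) :
    ‖(t : ℂ) ^ (-s - 1) * errorTerm a ρ t‖ ≤ (C₀ + ‖ρ‖) * t ^ (-(s.re + 1 - θ)) := by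
  have ht0 : 0 < t := zero_lt_one.trans ht
  rw [norm_mul, norm_cpow_eq_rpow_re_of_pos ht0]
  have hre : (-s - 1).re = -s.re - 1 := by simp
  rw [hre]
  calc t ^ (-s.re - 1) * ‖errorTerm a ρ t‖
      ≤ t ^ (-s.re - 1) * ((C₀ + ‖ρ‖) * t ^ θ) :=
        mul_le_mul_of_nonneg_left (norm_errorTerm_le hθ0 hA ht.le) (Real.rpow_nonneg ht0.le _)
    _ = (C₀ + ‖ρ‖) * (t ^ (-s.re - 1) * t ^ θ) := by ring
    _ = (C₀ + ‖ρ‖) * t ^ (-(s.re + 1 - θ)) := by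
        rw [← Real.rpow_add ht0]
        ring_nf

/-- `t ↦ t^{−s−1} E(t)` is integrable on `(1, ∞)` for `σ > θ`. [folklore] -/
theorem integrableOn_cpow_mul_errorTerm {s : ℂ} (hs : θ < s.re) :
    IntegrableOn (fun t : ℝ ↦ (t : ℂ) ^ (-s - 1) * errorTerm a ρ t) (Set.Ioi 1) := by
  have hexp : -(s.re + 1 - θ) < -1 := by linarith
  refine Integrable.mono' ((integrableOn_Ioi_rpow_of_lt hexp zero_lt_one).const_mul (C₀ + ‖ρ‖)) ?_ ?_
  · refine (ContinuousOn.aestronglyMeasurable ?_ measurableSet_Ioi).mul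
      (measurable_errorTerm a ρ).aestronglyMeasurable
    exact fun t ht ↦ (continuousAt_ofReal_cpow_const t _
      (Or.inr (zero_lt_one.trans ht).ne')).continuousWithinAt
  · exact ae_restrict_of_forall_mem measurableSet_Ioi fun t ht ↦
      norm_cpow_mul_errorTerm_le hθ0 hA s ht

/-- **`‖∫₁^∞ E(t) t^{−s−1} dt‖ ≤ (C₀ + ‖ρ‖)/(σ − θ)`** for `σ > θ`. [folklore] -/
theorem norm_mellin_errorTermC_le {s : ℂ} (hs : θ < s.re) :
    ‖mellin (errorTermC a ρ) (-s)‖ ≤ (C₀ + ‖ρ‖) / (s.re - θ) := by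
  rw [mellin_errorTermC]
  have hexp : -(s.re + 1 - θ) < -1 := by linarith
  calc ‖∫ t in Set.Ioi (1 : ℝ), (t : ℂ) ^ (-s - 1) * errorTerm a ρ t‖
      ≤ ∫ t in Set.Ioi (1 : ℝ), (C₀ + ‖ρ‖) * t ^ (-(s.re + 1 - θ)) :=
        norm_integral_le_of_norm_le ((integrableOn_Ioi_rpow_of_lt hexp zero_lt_one).const_mul _)
          (ae_restrict_of_forall_mem measurableSet_Ioi fun t ht ↦
            norm_cpow_mul_errorTerm_le hθ0 hA s ht)
    _ = (C₀ + ‖ρ‖) * (-(1 : ℝ) ^ (-(s.re + 1 - θ) + 1) / (-(s.re + 1 - θ) + 1)) := by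
        rw [integral_const_mul, integral_Ioi_rpow_of_lt hexp zero_lt_one]
    _ = (C₀ + ‖ρ‖) / (s.re - θ) := by
        have hu : -(s.re + 1 - θ) + 1 = -(s.re - θ) := by ring
        rw [Real.one_rpow, hu, neg_div_neg_eq, mul_one_div]

/-- **`G(s) = (s − 1) L(a, s)` for `σ > 1`** (partial summation, MV Theorem 1.3:
`L(a, s) = s ∫₁^∞ A(t) t^{−s−1} dt = ρ s/(s−1) + s ∫₁^∞ E(t) t^{−s−1} dt`), given `θ ≤ 1` and
absolute convergence of `L(a, s)`. [cite: MontgomeryVaughan2007, Theorem 1.3] -/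
theorem contG_eq_mul (hθ1 : θ ≤ 1) {s : ℂ} (hs : 1 < s.re) (hS : LSeriesSummable a s) :
    contG a ρ s = (s - 1) * LSeries a s := by
  have hC₀ := C₀_nonneg hA
  have hθs : θ < s.re := by linarith
  have hs1 : s - 1 ≠ 0 := by
    intro h1
    have := congrArg re h1
    simp at this
    linarith
  have hs1' : -s + 1 ≠ 0 := by
    intro h1
    apply hs1
    linear_combination -h1
  -- Step 1: the integral representation of the Dirichlet series
  have hO : (fun n : ℕ ↦ ∑ k ∈ Icc 1 n, a k) =O[atTop] fun n ↦ (n : ℝ) ^ (1 : ℝ) := by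
    refine IsBigO.of_bound (‖ρ‖ + C₀) ?_
    filter_upwards [eventually_ge_atTop 1] with n hn
    have hn' : (1 : ℝ) ≤ n := by exact_mod_cast hn
    rw [Real.rpow_one, Real.norm_of_nonneg (by positivity)]
    have h1 := hA n hn
    have h2 : (n : ℝ) ^ θ ≤ n := by
      conv_rhs => rw [← Real.rpow_one (n : ℝ)]
      exact Real.rpow_le_rpow_of_exponent_le hn' hθ1
    calc ‖∑ k ∈ Icc 1 n, a k‖ = ‖(∑ k ∈ Icc 1 n, a k - ρ * n) + ρ * n‖ := by ring_nf
      _ ≤ ‖∑ k ∈ Icc 1 n, a k - ρ * n‖ + ‖ρ * (n : ℂ)‖ := norm_add_le _ _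
      _ ≤ C₀ * (n : ℝ) ^ θ + ‖ρ‖ * n := by
          rw [norm_mul, Complex.norm_natCast]; exact add_le_add h1 le_rfl
      _ ≤ C₀ * n + ‖ρ‖ * n := by gcongr
      _ = (‖ρ‖ + C₀) * n := by ring
  have hL := LSeries_eq_mul_integral a zero_le_one (by simpa using hs) hS hO
  -- Step 2: rewrite the integrand on `(1, ∞)`
  have hint_eq : ∫ t in Set.Ioi (1 : ℝ), (∑ k ∈ Icc 1 ⌊t⌋₊, a k) * (t : ℂ) ^ (-(s + 1)) =
      ∫ t in Set.Ioi (1 : ℝ), (ρ * (t : ℂ) ^ (-s) + (t : ℂ) ^ (-s - 1) * errorTerm a ρ t) := by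
    refine setIntegral_congr_fun measurableSet_Ioi fun t ht ↦ ?_
    have ht0 : (0 : ℝ) < t := zero_lt_one.trans ht
    have ht0' : (t : ℂ) ≠ 0 := ofReal_ne_zero.mpr ht0.ne'
    have hI : (∑ k ∈ Icc 1 ⌊t⌋₊, a k) = ρ * t + errorTerm a ρ t := by
      unfold errorTerm partialSum; ring
    have hpow : (t : ℂ) ^ (-(s + 1)) = (t : ℂ) ^ (-s - 1) := by ring_nf
    have hpow2 : (t : ℂ) ^ (-s) = (t : ℂ) ^ (-s - 1) * (t : ℂ) := by
      conv_lhs => rw [show (-s : ℂ) = (-s - 1) + 1 by ring]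
      rw [cpow_add _ _ ht0', cpow_one]
    rw [hI, hpow, hpow2]
    ring
  -- Step 3: split the integral and evaluate `∫₁^∞ t^{-s} dt = 1/(s-1)`
  have hi1 : IntegrableOn (fun t : ℝ ↦ ρ * (t : ℂ) ^ (-s)) (Set.Ioi 1) :=
    (integrableOn_Ioi_cpow_of_lt (by simpa using hs : (-s).re < -1) zero_lt_one).const_mul _
  have hi2 := integrableOn_cpow_mul_errorTerm hθ0 hA (s := s) hθs
  have hcpow : ∫ t in Set.Ioi (1 : ℝ), (t : ℂ) ^ (-s) = -1 / (-s + 1) := by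
    rw [integral_Ioi_cpow_of_lt (by simpa using hs : (-s).re < -1) zero_lt_one, ofReal_one,
      one_cpow]
  rw [hL, hint_eq, integral_add hi1 hi2, integral_const_mul, hcpow, ← mellin_errorTermC, contG]
  field_simp
  ring

/-- **Growth of `G`**: `‖G(s)‖ ≤ ‖ρ‖‖s‖ + ‖s‖‖s − 1‖(C₀ + ‖ρ‖)/(σ − θ)` for `σ > θ`. [folklore] -/
theorem norm_contG_le {s : ℂ} (hs : θ < s.re) :
    ‖contG a ρ s‖ ≤ ‖ρ‖ * ‖s‖ + ‖s‖ * ‖s - 1‖ * ((C₀ + ‖ρ‖) / (s.re - θ)) := by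
  unfold contG
  calc ‖ρ * s + s * (s - 1) * mellin (errorTermC a ρ) (-s)‖
      ≤ ‖ρ * s‖ + ‖s * (s - 1) * mellin (errorTermC a ρ) (-s)‖ := norm_add_le _ _
    _ ≤ ‖ρ‖ * ‖s‖ + ‖s‖ * ‖s - 1‖ * ((C₀ + ‖ρ‖) / (s.re - θ)) := by
        rw [norm_mul, norm_mul, norm_mul]
        exact add_le_add le_rfl
          (mul_le_mul_of_nonneg_left (norm_mellin_errorTermC_le hθ0 hA hs) (by positivity))

end Hyp

/-! ### The pole-free case `ρ = 0` -/

section NoPole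

variable {a} {C₀ θ : ℝ} (hθ0 : 0 ≤ θ)
  (hA : ∀ N : ℕ, 1 ≤ N → ‖∑ k ∈ Icc 1 N, a k‖ ≤ C₀ * (N : ℝ) ^ θ)
include hθ0 hA

omit hθ0 in
/-- The hypothesis with `ρ = 0`. [folklore] -/
theorem hyp_zero : ∀ N : ℕ, 1 ≤ N → ‖∑ k ∈ Icc 1 N, a k - 0 * N‖ ≤ C₀ * (N : ℝ) ^ θ := by
  intro N hN; simpa using hA N hN

/-- **`F(s) = s ∫₁^∞ A(t)t^{−s−1} dt` is holomorphic on `σ > θ`.** [cite: LandauMathAnn1903, §9 p. 666] -/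
theorem differentiableOn_contF : DifferentiableOn ℂ (contF a) {s : ℂ | θ < s.re} := by
  intro s hs
  have hm := differentiableAt_mellin_errorTermC hθ0 (hyp_zero hA) (s := s) hs
  have : contF a = fun z ↦ z * mellin (errorTermC a 0) (-z) := rfl
  rw [this]
  exact (differentiableAt_id.mul hm).differentiableWithinAt

/-- **`F(s) = L(a, s)` for `σ > 1`** (`θ ≤ 1`, absolute convergence given).
[cite: MontgomeryVaughan2007, Theorem 1.3] -/
theorem contF_eq_LSeries (hθ1 : θ ≤ 1) {s : ℂ} (hs : 1 < s.re) (hS : LSeriesSummable a s) :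
    contF a s = LSeries a s := by
  have h := contG_eq_mul hθ0 (hyp_zero hA) hθ1 hs hS
  have hs1 : s - 1 ≠ 0 := by
    intro h1
    have := congrArg re h1
    simp at this
    linarith
  have hG : contG a 0 s = (s - 1) * contF a s := by unfold contG contF; ring
  rw [hG] at h
  exact mul_left_cancel₀ hs1 h

/-- **Growth of `F`**: `‖F(s)‖ ≤ ‖s‖ C₀/(σ − θ)` for `σ > θ`. [folklore] -/
theorem norm_contF_le {s : ℂ} (hs : θ < s.re) : ‖contF a s‖ ≤ ‖s‖ * (C₀ / (s.re - θ)) := by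
  unfold contF
  rw [norm_mul]
  have h := norm_mellin_errorTermC_le hθ0 (hyp_zero hA) hs
  rw [norm_zero, add_zero] at h
  exact mul_le_mul_of_nonneg_left h (norm_nonneg _)

/-- **Growth of `F` in the strip `θ + δ ≤ σ ≤ 3`**: `‖F(s)‖ ≤ (C₀/δ)(|t| + 4)` — the form of the
field `growth` of `TwistedZFRData` (`A = 1`, `C_g Q^A = C₀/δ` when `C₀ = C Q`). [folklore] -/
theorem norm_contF_le_of_le {δ : ℝ} (hδ : 0 < δ) {s : ℂ} (hs : θ + δ ≤ s.re) (hs3 : s.re ≤ 3) :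
    ‖contF a s‖ ≤ C₀ / δ * (|s.im| + 4) := by
  have hC₀ : 0 ≤ C₀ := by
    have := (norm_nonneg _).trans (hA 1 le_rfl); simpa using this
  have hsθ : θ < s.re := by linarith
  have h := norm_contF_le hθ0 hA hsθ
  have hns : ‖s‖ ≤ |s.im| + 4 := by
    have h1 := Complex.norm_le_abs_re_add_abs_im s
    have h2 : |s.re| ≤ 4 := by
      rw [abs_le]; constructor <;> linarith
    linarith
  have hdiv : C₀ / (s.re - θ) ≤ C₀ / δ := div_le_div_of_nonneg_left hC₀ hδ (by linarith)
  calc ‖contF a s‖ ≤ ‖s‖ * (C₀ / (s.re - θ)) := h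
    _ ≤ (|s.im| + 4) * (C₀ / δ) := mul_le_mul hns hdiv (by positivity) (by positivity)
    _ = C₀ / δ * (|s.im| + 4) := by ring

end NoPole

end PartialSumContinuation

end Literature.NumberTheory.LFunctions
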